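import Literature.Probability.RandomPlanarGeometry.SLEMarkovKernelFirstVisit
import Literature.Probability.RandomPlanarGeometry.RemainingDomainImage
import Literature.Probability.RandomPlanarGeometry.StoppedCompactifiedImage
import Literature.Probability.RandomPlanarGeometry.DrivingFunctionMeasurable
import Literature.Probability.Process.ContinuousHitting
import Mathlib.MeasureTheory.Constructions.BorelSpace.WithTop
import HarnessLib

/-!
# The domain-Markov kernel of chordal SLE_κ: deterministic surgery of a generated driver

Topic `Probability/RandomPlanarGeometry`; theorems and definitions (companion of
`SLEMarkovKernel.lean`, crux `stmt-CriticalPhenomena-0698`, stub `stub_isDomainMarkov`).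

For a chordal uniformizer `φ` of `D` and a driver `W` generated by a transient curve `γ`:
* `mkConfig`, `fullCurve`, `stoppedCurve` — the configuration at time `r`, the compactified
  image of the whole trace (a `Curve`), and the initial piece `u ↦ Φ (γ (r u))`;
* `stopAt_fullCurve_of_hit`, `sleMarkovKernel_stopAt_of_hit` — at the first hitting time `r` of a
  closed set `F` by `Φ ∘ γ`, the stopped class is the class of the stopped curve and the kernel
  there is the image law of the configuration at `r` (first-visit rigidity,
  `sleMarkovKernel_eq_of_isFirstVisit`);
* `stopAt_startFrom_fullCurve_of_forall_notMem`, `sleMarkovKernel_stopAt_of_forall_notMem` — the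
  case `F` never hit;
* `traceHitTime φ A c` — the hitting time of a closed set by the capacity-parametrised pull-back
  `Loewner.trace (drivingFunction φ c)` of a curve class, a Borel function of the class.

References: W. Werner (2007), §3.2; G. F. Lawler (2005), §6.3; D. Revuz, M. Yor (1999), Ch. I (4.6).
-/

noncomputable section

open Set Filter Topology MeasureTheory ProbabilityTheory Complex
open UpperHalfPlane (upperHalfPlaneSet isOpen_upperHalfPlaneSet)
open scoped NNReal ENNReal unitInterval

namespace Literature.Probability.RandomPlanarGeometry

/-! ### Deterministic part of the `markov` clause: one generated transient driver -/

section Deterministic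

variable {κ : ℝ≥0} {D : DobrushinDomain} {φ : ConformalEquiv upperHalfPlaneSet D.carrier}
  (hφ : D.IsChordalUniformizing φ) {W : ℝ≥0 → ℝ} (hW : Continuous W) {γ : ℝ≥0 → ℂ}
  (hγ : Loewner.IsGeneratedByCurve W γ) (htr : Tendsto (fun t ↦ ‖γ t‖) atTop atTop)

/-- The configuration of a generated driver at time `r`. [folklore] -/
def mkConfig (hφ : D.IsChordalUniformizing φ) (hW : Continuous W)
    (hγ : Loewner.IsGeneratedByCurve W γ) (r : ℝ≥0) : SLEConfig :=
  ⟨D, φ, hφ, W, hW, ⟨γ, hγ⟩, r⟩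

/-- The curve of `mkConfig` is the given generating curve (uniqueness of the trace). [folklore] -/
theorem mkConfig_γ (r : ℝ≥0) : (mkConfig hφ hW hγ r).γ = γ :=
  Loewner.IsGeneratedByCurve.trace_eq_holds hW hγ

include hφ hγ htr in
/-- The compactified image of the trace is a continuous curve. [cite: Lawler2005, §6.3] -/
theorem continuous_nodeValue_boundaryExtension :
    Continuous (nodeValue φ.boundaryExtension (D.pt 1) γ) :=
  continuous_nodeValue
    ((JordanDomain.continuousOn_boundaryExtension_holds D.toJordanDomain φ).mono
      (by rw [ConformalEquiv.closure_upperHalfPlaneSet_eq]))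
    (MarkedDomain.IsChordalUniformizing.tendsto_boundaryExtension_cocompact hφ)
    hγ.continuous (fun t ↦ hγ.im_nonneg t) (tendsto_cocompact_of_tendsto_norm_atTop htr)

/-- **The full curve** of the driver in `D`: the compactified image of its trace. [cite: Lawler2005, §6.3] -/
def fullCurve (hφ : D.IsChordalUniformizing φ) (hγ : Loewner.IsGeneratedByCurve W γ)
    (htr : Tendsto (fun t ↦ ‖γ t‖) atTop atTop) : Curve ℂ :=
  ⟨⟨nodeValue φ.boundaryExtension (D.pt 1) γ, continuous_nodeValue_boundaryExtension hφ hγ htr⟩⟩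

/-- The full curve IS the compactified image of the trace. [folklore] -/
theorem isCompactifiedImage_fullCurve :
    IsCompactifiedImage φ.boundaryExtension γ (D.pt 1) (fullCurve hφ hγ htr) :=
  isCompactifiedImage_nodeValue _ _ _ _

/-- The full curve ends at `b`. [folklore] -/
theorem target_fullCurve : (fullCurve hφ hγ htr).target = D.pt 1 :=
  (isCompactifiedImage_fullCurve hφ hγ htr).2

/-- `Φ ∘ γ` is continuous. [folklore] -/
theorem continuous_boundaryExtension_comp (hγ : Loewner.IsGeneratedByCurve W γ) :
    Continuous fun t ↦ φ.boundaryExtension (γ t) := by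
  have h := continuous_boundaryExtension_liftIm φ
  have heq : (fun t ↦ φ.boundaryExtension (γ t)) = fun t ↦ φ.boundaryExtension (Loewner.liftIm 0 (γ t)) := by
    funext t
    rw [Loewner.liftIm_of_le (hγ.im_nonneg t)]
  rw [heq]
  exact h.comp hγ.continuous

/-- **The stopped curve** at trace time `r`: `u ↦ Φ (γ (r u))`. [cite: Werner2007, §3.2] -/
def stoppedCurve (φ : ConformalEquiv upperHalfPlaneSet D.carrier)
    (hγ : Loewner.IsGeneratedByCurve W γ) (r : ℝ≥0) : Curve ℂ :=
  ⟨⟨fun u : I ↦ φ.boundaryExtension (γ (r * Real.toNNReal (u : ℝ))),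
    (continuous_boundaryExtension_comp hγ).comp
      (continuous_const.mul (continuous_real_toNNReal.comp continuous_subtype_val))⟩⟩

/-- Values of the stopped curve. [folklore] -/
theorem stoppedCurve_apply (r : ℝ≥0) (u : I) :
    stoppedCurve φ hγ r u = φ.boundaryExtension (γ (r * Real.toNNReal (u : ℝ))) := rfl

/-- Values of the stopped curve, subtype form. [folklore] -/
theorem stoppedCurve_apply' (r : ℝ≥0) (u : I) :
    stoppedCurve φ hγ r u = φ.boundaryExtension (γ (r * ⟨(u : ℝ), u.2.1⟩)) := by
  rw [stoppedCurve_apply]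
  congr 3
  apply NNReal.eq
  rw [Real.coe_toNNReal _ u.2.1]
  rfl

/-- The stopped curve ends at `Φ (γ r)`. [folklore] -/
theorem target_stoppedCurve (r : ℝ≥0) : (stoppedCurve φ hγ r).target = φ.boundaryExtension (γ r) := by
  rw [Curve.target_def, stoppedCurve_apply]
  simp

/-- The range of the stopped curve is `Φ (γ [0, r])`. [folklore] -/
theorem range_stoppedCurve (r : ℝ≥0) :
    (stoppedCurve φ hγ r).range = φ.boundaryExtension '' (γ '' Icc 0 r) := by
  ext v
  rw [Curve.mem_range]
  simp only [mem_image, mem_Icc, stoppedCurve_apply]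
  constructor
  · rintro ⟨u, rfl⟩
    refine ⟨γ (r * Real.toNNReal (u : ℝ)), ⟨r * Real.toNNReal (u : ℝ), ⟨bot_le, ?_⟩, rfl⟩, rfl⟩
    have h1 : Real.toNNReal (u : ℝ) ≤ 1 := by
      rw [← Real.toNNReal_one]
      exact Real.toNNReal_le_toNNReal u.2.2
    simpa using mul_le_mul_right h1 r
  · rintro ⟨_, ⟨t, ⟨-, htr⟩, rfl⟩, rfl⟩
    rcases eq_or_ne r 0 with hr0 | hr0
    · subst hr0
      have ht0 : t = 0 := le_antisymm htr bot_le
      subst ht0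
      exact ⟨0, by simp⟩
    · have hr0' : (0 : ℝ) < r := by exact_mod_cast pos_iff_ne_zero.2 hr0
      refine ⟨⟨(t : ℝ) / r, by positivity, (div_le_one hr0').2 (by exact_mod_cast htr)⟩, ?_⟩
      congr 2
      apply NNReal.eq
      rw [NNReal.coe_mul, Real.coe_toNNReal _ (by positivity)]
      field_simp

/-- **The configuration realises the triple of its stopped class.** [cite: Werner2007, §3.2] -/
theorem realises_mkConfig (r : ℝ≥0) {past : CurveClass ℂ}
    (hrange : past.range = φ.boundaryExtension '' (γ '' Icc 0 r))
    (htgt : past.target = φ.boundaryExtension (γ r)) :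
    (mkConfig hφ hW hγ r).Realises (remainingDomain D past) past.target (D.pt 1) := by
  refine ⟨?_, ?_, rfl⟩
  · exact (remainingDomain_eq_image_of_range_eq hφ hW hγ r past hrange).symm
  · change φ.boundaryExtension ((mkConfig hφ hW hγ r).γ r) = past.target
    rw [mkConfig_γ, htgt]

/-- First visit of the configuration from first visit of the curve. [folklore] -/
theorem isFirstVisit_mkConfig {r : ℝ≥0} (hfv : γ r ∉ γ '' Iio r) :
    (mkConfig hφ hW hγ r).γ (mkConfig hφ hW hγ r).r ∉ (mkConfig hφ hW hγ r).γ '' Iio (mkConfig hφ hW hγ r).r := by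
  change (mkConfig hφ hW hγ r).γ r ∉ (mkConfig hφ hW hγ r).γ '' Iio r
  rwa [mkConfig_γ]

/-- A first hitting time of `Φ ∘ γ` on a set is a first visit of `γ`. [folklore] -/
theorem firstVisit_of_firstHit {F : Set ℂ} {r : ℝ≥0} (hr : φ.boundaryExtension (γ r) ∈ F)
    (hbefore : ∀ s < r, φ.boundaryExtension (γ s) ∉ F) : γ r ∉ γ '' Iio r := by
  rintro ⟨s, hs, hsr⟩
  exact hbefore s hs (hsr ▸ hr)

variable {F : Set ℂ}

/-- **The stopped class at a hit**: if `Φ (γ r) ∈ F` and `Φ (γ s) ∉ F` for `s < r`, the full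
class stopped on `F` is the class of the stopped curve at `r`. [cite: Werner2007, §3.2] -/
theorem stopAt_fullCurve_of_hit (hF : IsClosed F) {r : ℝ≥0} (hr : φ.boundaryExtension (γ r) ∈ F)
    (hbefore : ∀ s < r, φ.boundaryExtension (γ s) ∉ F) :
    CurveClass.stopAt F (CurveClass.mk (fullCurve hφ hγ htr)) = CurveClass.mk (stoppedCurve φ hγ r) :=
  CurveClass.stopAt_mk_eq_of_isCompactifiedImage (isCompactifiedImage_fullCurve hφ hγ htr) hF hr hbefore
    _ fun u ↦ stoppedCurve_apply' hγ r u

/-- **The kernel at the stopped class of a hit is the image law of the configuration at the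
hitting time.** [cite: Werner2007, §3.2] -/
theorem sleMarkovKernel_stopAt_of_hit (h0 : HasSLETrace κ)
    (htr' : ∀ᵐ ω ∂Process.preWienerMeasure, Tendsto (fun t ↦ ‖sleTrace κ ω t‖) atTop atTop) (hF : IsClosed F) {r : ℝ≥0}
    (hr : φ.boundaryExtension (γ r) ∈ F) (hbefore : ∀ s < r, φ.boundaryExtension (γ s) ∉ F) :
    sleMarkovKernel κ D (CurveClass.stopAt F (CurveClass.mk (fullCurve hφ hγ htr))) =
      sleImageLaw κ (mkConfig hφ hW hγ r).ψ (D.pt 1) := by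
  rw [stopAt_fullCurve_of_hit hφ hγ htr hF hr hbefore]
  refine sleMarkovKernel_eq_of_isFirstVisit h0 htr'
    (isFirstVisit_mkConfig hφ hW hγ (firstVisit_of_firstHit hr hbefore)) ?_
  refine realises_mkConfig hφ hW hγ r ?_ ?_
  · rw [CurveClass.range_mk, range_stoppedCurve]
  · rw [CurveClass.target_mk, target_stoppedCurve]

/-- **The surgery when `F` is never hit**: the stopped class is the full class and the
restarted class is the constant curve at `b`. [folklore] -/
theorem stopAt_startFrom_fullCurve_of_forall_notMem (hF : IsClosed F)
    (hnever : ∀ s, φ.boundaryExtension (γ s) ∉ F) :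
    CurveClass.stopAt F (CurveClass.mk (fullCurve hφ hγ htr)) = CurveClass.mk (fullCurve hφ hγ htr) ∧
      CurveClass.startFrom F (CurveClass.mk (fullCurve hφ hγ htr)) =
        CurveClass.mk (Curve.const (D.pt 1)) :=
  CurveClass.stopAt_startFrom_mk_eq_of_forall_notMem (isCompactifiedImage_fullCurve hφ hγ htr) hF hnever

/-- **The kernel when `F` is never hit** is the Dirac mass at the constant curve at `b`. [folklore] -/
theorem sleMarkovKernel_stopAt_of_forall_notMem (hF : IsClosed F)
    (hnever : ∀ s, φ.boundaryExtension (γ s) ∉ F) :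
    sleMarkovKernel κ D (CurveClass.stopAt F (CurveClass.mk (fullCurve hφ hγ htr))) =
      Measure.dirac (CurveClass.mk (Curve.const (D.pt 1))) := by
  rw [(stopAt_startFrom_fullCurve_of_forall_notMem hφ hγ htr hF hnever).1]
  exact sleMarkovKernel_of_target_eq κ (by rw [CurveClass.target_mk, target_fullCurve])

end Deterministic

/-! ### The trace hitting time as a Borel function of the curve class (through the driving function) -/

section CurveFunctional

variable {D : DobrushinDomain} {φ : ConformalEquiv upperHalfPlaneSet D.carrier}

/-- **The capacity-parametrised pull-back of a curve class, jointly measurable in (class, time)**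
(continuous in time for every class, Borel in the class at every time). [folklore] -/
theorem measurable_uncurry_trace_drivingFunction (hφ : D.IsChordalUniformizing φ) :
    Measurable fun p : CurveClass ℂ × ℝ≥0 ↦ Loewner.trace (drivingFunction φ p.1) p.2 := by
  have h := measurable_uncurry_of_continuous_of_measurable
    (u := fun (t : ℝ≥0) (c : CurveClass ℂ) ↦ Loewner.trace (drivingFunction φ c) t)
    (fun c ↦ Loewner.continuous_trace (drivingFunction φ c))
    (fun t ↦ (measurable_pi_apply t).comp (measurable_trace_drivingFunction hφ))
  exact h.comp measurable_swap

/-- **The hitting time of a closed set by the pulled-back curve** `t ↦ γ_c(t)`,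
`γ_c = Loewner.trace (drivingFunction φ c)`: the first `t` with `γ_c t ∈ A` (`⊤` if none). For
the SLE curve class this is a.s. the trace hitting time of `A`. [cite: Werner2007, §3.2 (σ)] -/
def traceHitTime (φ : ConformalEquiv upperHalfPlaneSet D.carrier) (A : Set ℂ) (c : CurveClass ℂ) :
    WithTop ℝ≥0 :=
  hittingAfter (fun t (c : CurveClass ℂ) ↦ Loewner.trace (drivingFunction φ c) t) A 0 c

/-- **The trace hitting time is a Borel function of the curve class** (hitting time of a closed
set by an everywhere-continuous process with measurable marginals — a stopping time of the
constant filtration). [cite: RevuzYor1999, Ch. I Prop. (4.6)] -/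
theorem measurable_traceHitTime (hφ : D.IsChordalUniformizing φ) {A : Set ℂ} (hA : IsClosed A) :
    Measurable (traceHitTime φ A) := by
  set u : ℝ≥0 → CurveClass ℂ → ℂ := fun t c ↦ Loewner.trace (drivingFunction φ c) t with hu
  set f : Filtration ℝ≥0 (inferInstance : MeasurableSpace (CurveClass ℂ)) :=
    Filtration.const ℝ≥0 (inferInstance : MeasurableSpace (CurveClass ℂ)) le_rfl with hf
  have hadapt : Adapted f u := fun t ↦
    (measurable_pi_apply t).comp (measurable_trace_drivingFunction hφ)
  have hst : IsStoppingTime f (hittingAfter u A 0) :=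
    Process.isStoppingTime_hittingAfter_of_continuous hadapt
      (fun c ↦ Loewner.continuous_trace (drivingFunction φ c)) hA
  exact hst.measurable'

/-- At a finite hitting time the pulled-back curve is in `A`. [folklore] -/
theorem trace_mem_of_traceHitTime_eq {A : Set ℂ} (hA : IsClosed A) {c : CurveClass ℂ} {r : ℝ≥0}
    (h : traceHitTime φ A c = r) : Loewner.trace (drivingFunction φ c) r ∈ A :=
  Process.mem_of_hittingAfter_zero_eq_coe (u := fun t (c : CurveClass ℂ) ↦ Loewner.trace (drivingFunction φ c) t)
    hA (Loewner.continuous_trace _) h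

/-- Before the hitting time the pulled-back curve is off `A`. [folklore] -/
theorem trace_notMem_of_lt_traceHitTime {A : Set ℂ} {c : CurveClass ℂ} {s : ℝ≥0}
    (h : (s : WithTop ℝ≥0) < traceHitTime φ A c) : Loewner.trace (drivingFunction φ c) s ∉ A :=
  Process.notMem_of_coe_lt_hittingAfter_zero (u := fun t (c : CurveClass ℂ) ↦ Loewner.trace (drivingFunction φ c) t) h

/-- If the hitting time is `⊤` the pulled-back curve never meets `A`. [folklore] -/
theorem trace_notMem_of_traceHitTime_eq_top {A : Set ℂ} {c : CurveClass ℂ}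
    (h : traceHitTime φ A c = ⊤) (s : ℝ≥0) : Loewner.trace (drivingFunction φ c) s ∉ A := by
  intro hs
  have := (Process.hittingAfter_zero_ne_top_iff (u := fun t (c : CurveClass ℂ) ↦
    Loewner.trace (drivingFunction φ c) t) (s := A) (ω := c)).2 ⟨s, hs⟩
  exact this h

end CurveFunctional

end Literature.Probability.RandomPlanarGeometry

end
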